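import Summits.NavierStokesRegularity.NavierStokesRegularity.Theorems.WakeRatchetExtractionClock

/-!
# WakeRatchetMinimalBlowupExtraction — LINE g9-1 «clocked frames», part 7/7: ⟨22744⟩ `WakeRatchet.MinimalBlowupExtraction`

Ideator ns-idea-1 g9, LINE g9-1 «clocked frames» (critic of record idea-crit-3): part 7 of 7 of the split landing kit of
`extraction_proved.lean` (sha16 849d037365163546, the sorry-free proof of route item ⟨stmt-NavierStokesRegularity-22744⟩
`WakeRatchet.MinimalBlowupExtraction`), cut at the author's seams with every declaration VERBATIM; parts chain by import
(1 Ascoli → 2 Frames → 3 FrameLip → 4 Action → 5 Law → 6 Clock → 7 MinimalBlowupExtraction).  MODEL lattice only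
(Tao 2016 averaged Navier–Stokes cascade); no summit is proved by a line — part 7 closes ONE crux (K2) of route WakeRatchet.

This part: Survival passes to the limit (`stubSurvival_holds : StubSurvival`) and the assembly
`theorem minimalBlowupExtraction : Summit.NavierStokesRegularity.NavierStokesRegularity.Theses.WakeRatchet.MinimalBlowupExtraction`
(ε_R := 1) — the type IS the route decl; landing this part with `--workitem stmt-NavierStokesRegularity-22744` closes the item.
-/

noncomputable section

set_option linter.dupNamespace false

namespace Summit.NavierStokesRegularity.NavierStokesRegularity.Cruxes.MinimalBlowupExtraction.ClockedFrames

open Set Filter Topology MeasureTheory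
open scoped RealInnerProductSpace
open Literature.Analysis.FluidPDE Literature.Analysis.FluidPDE.TaoCascade
open Summit.NavierStokesRegularity.NavierStokesRegularity.Cruxes.MinimalBlowupExtraction.Extraction
  (exists_subseq_continuousLimit_param)
open Summit.NavierStokesRegularity.NavierStokesRegularity.Theorems.DSSOneShift
  (hasDerivWithinAt_shellVec bigLam_zpow_eq_rpow)
open Summit.NavierStokesRegularity.NavierStokesRegularity.Theorems.WakeRatchetCritical
  (tableQ_smul tableA_smul tableB_smul_smul continuous_tableB)
open Summit.NavierStokesRegularity.NavierStokesRegularity.Theorems.TransitMassLedgerEnergy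
  (continuous_tableQ continuous_tableA continuous_tableB_comp)
open Summit.NavierStokesRegularity.NavierStokesRegularity.Cruxes.MinimalBlowupExtraction.TableCont

/-! ## The firing of shell `n + m` seen in the frame centred at shell `m` -/

variable {ε₀ T c' κ₁ κ₂ : ℝ} {X : Fin 4 → ℤ → ℝ → ℝ} {τ : ℕ → ℝ}

/-- The frame log-time at which frame `m` sees the firing of shell `n + m`. -/
def ufire (T : ℝ) (τ : ℕ → ℝ) (n m : ℕ) : ℝ := Real.log ((T - τ m) / (T - τ (n + m)))

/-- Under clocked firing every firing time is before the blow-up time: `0 < T − τ k`. -/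
theorem gap_pos (hclk : ClockedFiring ε₀ T c' κ₁ κ₂ X τ) (k : ℕ) : 0 < T - τ k := by
  have h := (hclk k).2.1
  linarith

/-- The physical weight at shell `1`: `physWeight 1 ε₀ = ((1+ε₀)^4)⁻¹`. -/
theorem physWeight_one (hε : 0 < ε₀) : physWeight 1 ε₀ = (((1 + ε₀) ^ 4)⁻¹ : ℝ) := by
  have hb : (0 : ℝ) < 1 + ε₀ := by linarith
  unfold physWeight
  rw [Real.rpow_one]
  field_simp

/-- At the firing log-time the frame is the rescaled fired shell: `frame = (Λ^k (T − τ_k)) • X_k(τ_k)`, `k = n+m`. -/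
theorem frame_at_firing (hclk : ClockedFiring ε₀ T c' κ₁ κ₂ X τ) (n m : ℕ) :
    frame ε₀ T X m (-Real.log (T - τ m)) (n : ℤ) (ufire T τ n m) =
      (bigLam ε₀ ^ (n + m) * (T - τ (n + m))) • shellVec X ((n + m : ℕ) : ℤ) (τ (n + m)) := by
  have gm := gap_pos hclk m
  have gk := gap_pos hclk (n + m)
  have he : Real.exp (-(ufire T τ n m + -Real.log (T - τ m))) = T - τ (n + m) := by
    unfold ufire
    rw [Real.log_div gm.ne' gk.ne', show -(Real.log (T - τ m) - Real.log (T - τ (n + m)) +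
      -Real.log (T - τ m)) = Real.log (T - τ (n + m)) by ring, Real.exp_log gk]
  simp only [frame, renorm]
  rw [he, show ((n : ℤ) + (m : ℕ)) = ((n + m : ℕ) : ℤ) by push_cast; ring, zpow_natCast, sub_sub_cancel]

/-- **Zero-slack identity**: the `a = 1` weighted frame energy at the firing, in terms of the clock and the floor. -/
theorem weighted_frame_at_firing (hε : 0 < ε₀) (hclk : ClockedFiring ε₀ T c' κ₁ κ₂ X τ) (n m : ℕ) :
    physWeight 1 ε₀ ^ n * (Real.exp (2 * ufire T τ n m) *
        ‖frame ε₀ T X m (-Real.log (T - τ m)) (n : ℤ) (ufire T τ n m)‖ ^ 2) =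
      ((T - τ m) * ((1 + ε₀) ^ m) ^ 2) ^ 2 *
        ((1 + ε₀) ^ (n + m) * ‖shellVec X ((n + m : ℕ) : ℤ) (τ (n + m))‖ ^ 2) := by
  have hb : (0 : ℝ) < 1 + ε₀ := by linarith
  have gm := gap_pos hclk m
  have gk := gap_pos hclk (n + m)
  have hL : 0 < bigLam ε₀ ^ (n + m) := pow_pos (bigLam_pos (by linarith)) _
  have hexp : Real.exp (2 * ufire T τ n m) = ((T - τ m) / (T - τ (n + m))) ^ 2 := by
    unfold ufire
    rw [two_mul, Real.exp_add, Real.exp_log (by positivity), sq]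
  rw [frame_at_firing hclk n m, norm_smul, Real.norm_of_nonneg (by positivity), hexp, physWeight_one hε]
  simp only [mul_pow]
  rw [bigLam_pow_sq hε (n + m), pow_add, inv_pow, ← pow_mul (1 + ε₀) 4 n,
    show 4 * n = n * 4 from Nat.mul_comm _ _, pow_mul]
  have hA : 0 < (1 + ε₀) ^ n := pow_pos hb n
  have hB : 0 < (1 + ε₀) ^ m := pow_pos hb m
  generalize (1 + ε₀) ^ n = A at hA ⊢
  generalize (1 + ε₀) ^ m = B at hB ⊢
  field_simp

/-- **The floor in the frame**: `κ₁² c' ≤` the weighted frame energy at the firing. -/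
theorem floor_at_firing (hε : 0 < ε₀) (hκ₁ : 0 < κ₁) (hc' : 0 < c') (hclk : ClockedFiring ε₀ T c' κ₁ κ₂ X τ)
    (n m : ℕ) :
    κ₁ ^ 2 * c' ≤ physWeight 1 ε₀ ^ n * (Real.exp (2 * ufire T τ n m) *
        ‖frame ε₀ T X m (-Real.log (T - τ m)) (n : ℤ) (ufire T τ n m)‖ ^ 2) := by
  have hb : (0 : ℝ) < 1 + ε₀ := by linarith
  rw [weighted_frame_at_firing hε hclk n m]
  obtain ⟨-, -, hlow, -, -⟩ := hclk m
  obtain ⟨-, -, -, -, hfl⟩ := hclk (n + m)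
  have hP : 0 < (1 + ε₀) ^ (2 * m) := pow_pos hb _
  have h1 : κ₁ ≤ (T - τ m) * ((1 + ε₀) ^ m) ^ 2 := by
    rw [← pow_mul, Nat.mul_comm, ← (mul_inv_le_iff₀ hP)]
    exact hlow
  exact mul_le_mul (pow_le_pow_left₀ hκ₁.le h1 2) hfl hc'.le (sq_nonneg _)

/-- **The window**: the two-sided clock confines the firing log-time seen in frame `m` to a window depending on `n` only. -/
theorem ufire_window (hε : 0 < ε₀) (hκ₁ : 0 < κ₁) (hκ₂ : 0 < κ₂) (hclk : ClockedFiring ε₀ T c' κ₁ κ₂ X τ)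
    (n m : ℕ) :
    ufire T τ n m ∈ Icc (Real.log (κ₁ / κ₂ * (1 + ε₀) ^ (2 * n))) (Real.log (κ₂ / κ₁ * (1 + ε₀) ^ (2 * n))) := by
  have hb : (0 : ℝ) < 1 + ε₀ := by linarith
  have gm := gap_pos hclk m
  have gk := gap_pos hclk (n + m)
  obtain ⟨-, -, hml, hmu, -⟩ := hclk m
  obtain ⟨-, -, hkl, hku, -⟩ := hclk (n + m)
  have hR : 0 < (1 + ε₀) ^ (2 * n) := pow_pos hb _
  have hP : 0 < (1 + ε₀) ^ (2 * m) := pow_pos hb _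
  have hQ : (1 + ε₀) ^ (2 * (n + m)) = (1 + ε₀) ^ (2 * n) * (1 + ε₀) ^ (2 * m) := by
    rw [mul_add, pow_add]
  rw [hQ] at hkl hku
  unfold ufire
  constructor
  · refine Real.log_le_log (by positivity) ?_
    rw [le_div_iff₀ gk]
    calc κ₁ / κ₂ * (1 + ε₀) ^ (2 * n) * (T - τ (n + m))
        ≤ κ₁ / κ₂ * (1 + ε₀) ^ (2 * n) * (κ₂ * ((1 + ε₀) ^ (2 * n) * (1 + ε₀) ^ (2 * m))⁻¹) :=
          mul_le_mul_of_nonneg_left hku (by positivity)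
      _ = κ₁ * ((1 + ε₀) ^ (2 * m))⁻¹ := by field_simp
      _ ≤ T - τ m := hml
  · refine Real.log_le_log (by positivity) ?_
    rw [div_le_iff₀ gk]
    calc T - τ m ≤ κ₂ * ((1 + ε₀) ^ (2 * m))⁻¹ := hmu
      _ = κ₂ / κ₁ * (1 + ε₀) ^ (2 * n) * (κ₁ * ((1 + ε₀) ^ (2 * n) * (1 + ε₀) ^ (2 * m))⁻¹) := by
          field_simp
      _ ≤ κ₂ / κ₁ * (1 + ε₀) ^ (2 * n) * (T - τ (n + m)) :=
          mul_le_mul_of_nonneg_left hkl (by positivity)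

/-- The lower edge of the window drifts to `+∞` with the frame-shell `n`. -/
theorem window_tendsto (hε : 0 < ε₀) (hκ₁ : 0 < κ₁) (hκ₂ : 0 < κ₂) :
    Tendsto (fun n : ℕ => Real.log (κ₁ / κ₂ * (1 + ε₀) ^ (2 * n))) atTop atTop := by
  have h1 : (1 : ℝ) < (1 + ε₀) ^ 2 := by nlinarith
  have h2 : Tendsto (fun n : ℕ => κ₁ / κ₂ * (1 + ε₀) ^ (2 * n)) atTop atTop := by
    have h3 := (tendsto_pow_atTop_atTop_of_one_lt h1).const_mul_atTop (div_pos hκ₁ hκ₂)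
    refine h3.congr fun n => ?_
    rw [pow_mul]
  exact Real.tendsto_log_atTop.comp h2

/-! ## Survival passes to the limit -/

/-- **`stub_survival` PROVED**. -/
theorem stubSurvival_holds : StubSurvival := by
  intro ε₀ T c' κ₁ κ₂ X τ φ W hε hT hc' hκ₁ hκ₂ hclk hφ hconv
  classical
  refine ⟨κ₁ ^ 2 * c', by positivity, fun N => ?_⟩
  -- choose the frame-shell `n ≥ N` so deep that the whole window lies beyond `N`
  obtain ⟨n, hLo, hnN⟩ := (((window_tendsto hε hκ₁ hκ₂).eventually_ge_atTop (N : ℝ)).and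
    (eventually_ge_atTop N)).exists
  refine ⟨n, hnN, ?_⟩
  -- the firing log-times seen in the frames `φ j`, a bounded sequence
  set u : ℕ → ℝ := fun j => ufire T τ n (φ j) with hu
  have hwin : ∀ j, u j ∈ Icc (Real.log (κ₁ / κ₂ * (1 + ε₀) ^ (2 * n)))
      (Real.log (κ₂ / κ₁ * (1 + ε₀) ^ (2 * n))) := fun j => ufire_window hε hκ₁ hκ₂ hclk n (φ j)
  obtain ⟨σ, hσmem, ψ, hψ, hlim⟩ := tendsto_subseq_of_bounded (Metric.isBounded_Icc _ _) hwin
  rw [closure_Icc] at hσmem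
  refine ⟨σ, le_trans hLo hσmem.1, ?_⟩
  -- interpolate: `v = u` on the range of `ψ`, `σ` elsewhere; `v → σ`
  set v : ℕ → ℝ := fun j => if ∃ k, ψ k = j then u j else σ with hv
  have hvlim : Tendsto v atTop (𝓝 σ) := by
    rw [Metric.tendsto_atTop]
    intro δ hδ
    obtain ⟨K, hK⟩ := Metric.tendsto_atTop.1 hlim δ hδ
    refine ⟨ψ K, fun j hj => ?_⟩
    by_cases h : ∃ k, ψ k = j
    · obtain ⟨k, rfl⟩ := h
      have hk : K ≤ k := hψ.le_iff_le.1 hj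
      have e : v (ψ k) = u (ψ k) := by rw [hv]; exact if_pos ⟨k, rfl⟩
      rw [e]
      exact hK k hk
    · have e : v j = σ := by rw [hv]; exact if_neg h
      rw [e, dist_self]
      exact hδ
  -- continuous convergence along the subsequence, at the firing log-times
  have hfr : Tendsto (fun k => frame ε₀ T X (φ (ψ k)) (-Real.log (T - τ (φ (ψ k)))) (n : ℤ) (u (ψ k)))
      atTop (𝓝 (W n σ)) := by
    have h := (hconv (n : ℤ) v σ hvlim).comp hψ.tendsto_atTop
    refine h.congr fun k => ?_
    have e : v (ψ k) = u (ψ k) := by rw [hv]; exact if_pos ⟨k, rfl⟩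
    simp only [Function.comp_apply, e]
  -- the weighted energies converge and carry the floor
  have hg : Tendsto (fun k => physWeight 1 ε₀ ^ n * (Real.exp (2 * u (ψ k)) *
      ‖frame ε₀ T X (φ (ψ k)) (-Real.log (T - τ (φ (ψ k)))) (n : ℤ) (u (ψ k))‖ ^ 2)) atTop
      (𝓝 (physWeight 1 ε₀ ^ n * (Real.exp (2 * σ) * ‖W n σ‖ ^ 2))) := by
    have he : Tendsto (fun k => Real.exp (2 * u (ψ k))) atTop (𝓝 (Real.exp (2 * σ))) :=
      (Real.continuous_exp.tendsto _).comp (hlim.const_mul 2)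
    exact (he.mul (hfr.norm.pow 2)).const_mul _
  have hfloor : ∀ k, κ₁ ^ 2 * c' ≤ physWeight 1 ε₀ ^ n * (Real.exp (2 * u (ψ k)) *
      ‖frame ε₀ T X (φ (ψ k)) (-Real.log (T - τ (φ (ψ k)))) (n : ℤ) (u (ψ k))‖ ^ 2) :=
    fun k => floor_at_firing hε hκ₁ hc' hclk n (φ (ψ k))
  exact ge_of_tendsto hg (Eventually.of_forall hfloor)

/-! ## ⟨22744⟩ PROVED: the three registered stubs of LINE g9-1 are theorems -/

/-- **`WakeRatchet.MinimalBlowupExtraction` (item ⟨stmt-NavierStokesRegularity-22744⟩, crux K2 of the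
critical-element split) — PROVED.**  For every table radius `R` take `ε_R := 1`; for a pinned blow-up wave of a
table in the class: the clock (`stubClock_holds`) re-selects firing times with a two-sided self-similar clock and
an amplitude floor; the clocked frames are eventually bounded and equi-Lipschitz (`stubFrameSup_holds`,
`stubFrameLip_holds`), a diagonal subsequence converges continuously together with the covariant viscosity
parameters (`exists_subseq_continuousLimit_param`), the limit is an admissible eternal solution of the renormalised
VISCOUS lattice with `ν̂ ∈ [νκ₁, νκ₂]` (`closureLaw_holds`: the exact frame law passes to the limit in integral
form; `closureAction_holds`: the window action passes by dominated convergence; envelope, bound, sign pointwise),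
uniformly bounded, and it keeps surviving forward (`stubSurvival_holds`: the firing floor is seen in frame `m` at a
log-time in a compact window).  Inputs: Literature `Tao2016AveragedNS/*` (definitions and table bounds only) and
the tree Theorems `DSSOneShift.hasDerivWithinAt_shellVec`, `bigLam_zpow_eq_rpow`, `WakeRatchetCritical.table*_smul`,
`continuous_table*`; Mathlib.  No summit is proved by this theorem: it closes ONE crux of route WakeRatchet. -/
theorem minimalBlowupExtraction :
    Summit.NavierStokesRegularity.NavierStokesRegularity.Theses.WakeRatchet.MinimalBlowupExtraction := by
  intro R hR
  refine ⟨1, one_pos, fun ε₀ hε _hε1 α X₀ hα ν T C c X hP => ?_⟩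
  have hP' : Pinned ε₀ α X₀ ν T C c X := hP
  obtain ⟨c', κ₁, κ₂, hc', hκ₁, hκ₂, τ, hτ⟩ := stubClock_holds ε₀ R α X₀ ν T C c X hε hα hP'
  obtain ⟨νh, W, φ, hφ, hW, hUB, hconv⟩ :=
    stubOmegaLimit_holds ε₀ R α X₀ ν T C c X hε hα hP' c' κ₁ κ₂ τ hκ₁ hτ
  exact ⟨νh, W, hW, hUB, stubSurvival_holds ε₀ T c' κ₁ κ₂ X τ φ W hε hP'.2.1 hc' hκ₁ hκ₂ hτ hφ hconv⟩

end Summit.NavierStokesRegularity.NavierStokesRegularity.Cruxes.MinimalBlowupExtraction.ClockedFrames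

end
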